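import Summits.QuantumFields.BalabanUV.T4Continuum.Spine.NE1p.DressedSourceAnalyticSlotLetters
import Summits.QuantumFields.BalabanUV.T4Continuum.Spine.NE1p.DressedSmallFieldGeometryFaces

/-!
# T⁴ programme, spine estimate NE1′ (node O3b/H2) — S46's SOURCE-ANALYTIC, RESPONSE AND JOINT ENDs AT THE SUBSTRATE's GAUSSIAN
# LETTERS OF RECORD ON THE TORUS OF THE PAPERS: `analytic_and_bounded_locE_of_coreLettersOf` ∕ `muDeriv_locE_le_of_coreLettersOf` ∕
# `analytic_and_bounded_locE_opSource_of_coreLettersOf` at pv22's `tgeometry 4 N` — NO geometry hypothesis AND NO operator-letter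
# block, constants LOCATED as numerals (ν = 9, κ₀ = 64·log 162, K₀ = K₀(64,8), c₁ = 64, b₅ = 5·r₁), and the S37∕S45 ∘ S30 commuting
# squares in kernel (torus-then-letters = letters-then-torus)

Cell `pub-balaban`, sub-cell `t4`, BINDER-OWNERS row NE1′ (owner lineage t4-ne1p-p1); NE1′ formalisation crew, unit
`b2b-balaban-t4-ne1p-formalise-leaf-07` (LEAF PROVER 07, generation 17); crew row S⟨next⟩ of `t4/formal/NE1p/LEAVES.md` (INTENT
`CLAIMS.log` 2026-08-20 — the follower row S46's holder leaf-03-g13 NAMED at its SEAT-CLOSING l.21119 «S46 on the torus (S31 pattern) …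
NOT started (none owed)»; this seat READ S46 as X177, l.21152).  ADDITIVE — imports crew row S46
`Spine/NE1p/DressedSourceAnalyticSlotLetters` (leaf-03-g13, p235653; → S42 `DressedJointAnalyticOnCores` → S33 → N0r …; → S30
`DressedSmallFieldOnCoresSlotLetters` → the SUBSTRATE cell's `Support/SubstrateGaussianLettersBall` ∕ `SubstrateSlotsOfRecord` ∕
`SubstrateActivities`) and S24 `Spine/NE1p/DressedSmallFieldGeometryFaces` (`K₀_four`; → N0o `DressedSmallFieldGeometry` `torus_consts`)
ONLY; THEOREMS ONLY (+ two `example`s; 0 `def`, 0 `def … : Prop`, 0 cite); nothing of S46 ∕ S37 ∕ S45 ∕ S30 ∕ S31 ∕ S33 ∕ S42 ∕ N0m–N0r ∕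
the substrate ∕ row NE5 ∕ pv22 is restated — their declarations are used BY NAME.

WHY THIS FILE.  S46 re-socketed the unit's S33 §4 (holomorphy in the source + the μ-uniform (2.41) envelope; the linear RESPONSE) and
S42 §5 (the JOINT (operator datum, source) END) at the substrate's CORE LETTERS OF RECORD `coreLettersOf A` (`N := gaussN (linForm base
rd)`, `q := gaussQ (linForm base rd) coords`), N0r's three operator-letter blocks `hm` ∕ `hN` ∕ `hq` DISCHARGED by S30 §1 into the
substrate's PRIMITIVE per-factor scalar letter conditions — but kept a GENERAL `Ge : B13Resummation.Geometry 𝔇 Cube` (clauses at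
`Ge.κ₀` ∕ `Ge.K₀` ∕ `Ge.ν` ∕ `Ge.c₁`, `hb : r₁·5 ≤ b₅`).  S37 `DressedSourceAnalyticOnCoresTorus` and S45 `DressedJointAnalyticOnCoresTorus`
put S33 §4 ∕ S42 §5 on pv22's CONSTRUCTED torus geometry but kept the operator-letter blocks DISPLAYED at general letters `ℓ`; S31
`DressedSmallFieldOnCoresSlotLettersTorus` did «letters + torus» for N0r's attached-part ∕ μ-part ENDs only.  THIS FILE closes the
square for the unit's three analytic ENDs — S31's pattern VERBATIM, nothing else:
* §1 at `𝔇 := tsys 4 N`, `Ge := tgeometry 4 N` (pv22), constants LOCATED AS NUMERALS by N0o `torus_consts` + S24 `K₀_four` BY NAME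
  (ν = 9, κ₀ = 64·log 162, c₁ = 64, K₀ = `B12TreeDecay.K₀ 64 8`; print's (2.27) `c = 5` through `b₅ := 5·r₁`):
  **`analytic_and_bounded_locE_of_coreLettersOf_torus`** ∕ **`muDeriv_locE_le_of_coreLettersOf_torus`** ∕
  **`analytic_and_bounded_locE_opSource_of_coreLettersOf_torus`** — S46 §2 ∕ §2 ∕ §3 ONCE BY NAME each.  Binders = S46's with the geometry
  GONE: `A : ∀ Z j, ActLetters …`, the room `hroom`, `0 ≤ R′ k`, the substrate's primitive per-factor letter conditions `hbase` ∕ `hrdm` ∕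
  `hβ₀` ∕ `hd₀` ∕ `hrd`, the CENTRE CONDITIONS `hctr`, the radius smallnesses `hbud` ∕ `hmq`, the class radii `hO` ∕ `hH` (no `o` ∕ `hO`
  for the joint END), `terms` ∕ `emb` ∕ `hscale`, the LOCATED clauses `r₁ + 2·(64·log 162) + 2 ≤ R` and `A′·(e^{5r₁+1}·K₀(64,8)·9·64) ≤ 1`,
  (B3) `hM3` on S30's EXPLICIT letters with `Z.1 ⊆ X₀.1` and `torusTreeLen`; conclusions LITERALLY the crew's ONE torus currency for the
  analytic faces (S37 §2's ∕ S45's right-hand sides): holomorphy in `s` on `‖s‖ < μ₁` resp. in `(o, s)` on `ball (ctr k g U).1 (ROp k) ×ˢ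
  ball 0 μ₁` with the envelope `e·9·64·K₀(64,8)²·A′·e^{−r₁·torusTreeLen X₀}`, and the response bound `2·(that)∕(μ₁ − μ₀)`.
  CENSUS vs S46 §2∕§3 (binders): MINUS = [`𝔇`, `Cube`, `Ge`, `b₅`, `hb`]; PLUS = [`N`, `[NeZero N]`]; `X₀` explicit; rest IDENTICAL.
* §2 two `example`s — THE COMMUTING SQUARES IN KERNEL: §1's `analytic_and_bounded_locE_of_coreLettersOf_torus` IS the unit's S33 §4
  `analytic_and_bounded_locE_of_actOfLetters` AT the torus geometry (the END of which S37 §2's `…_actOfLetters_torus` is the one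
  application) at `ℓ := coreLettersOf D P Op 𝒵 dom Jc V mI A` with S30 §1's three block producers `margin_pos` ∕ `hN_coreLettersOf` ∕
  `hq_coreLettersOf` BY NAME, and §1's joint END IS S42 §5 `analytic_and_bounded_locE_opSource_of_actOfLetters` AT the torus geometry (S45's)
  at the same letters and blocks — torus-then-letters = letters-then-torus, NO new inequality.  (S37 ∕ S45 themselves are not imported for
  two examples: the squares are written against the ENDs they apply once, which keeps the import set at S46 + S24.)

ELABORATION NOTE (instance hygiene, no mathematics; S31's note verbatim in substance).  The substrate's `Support/B13Carriers` — in this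
file's cone through S30 — registers the global instance `TwoRuns.instDecidableEqTDom`; the bare text `locE (TTouch …) …` would put
`Dom := TDom 4 N` with THAT instance and stop being the by-name specialisation of S46's ENDs (which elaborate `locE` CLASSICALLY, `open
Classical in`).  Each conclusion below therefore pins `locE (Dom := (tsys 4 N).Dom) …` exactly as S31 does: the statements PRINT as
S37's ∕ S45's (`locE TTouch (fun Z => ↑Z) … ↑X₀`) and are closed by S46's ENDs BY NAME with no cast.

WHAT STAYS DISPLAYED (binders, by name; NOTHING instantiated on Bałaban's densities): `hroom`, `0 ≤ R′ k`; per factor the substrate's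
primitive letter conditions, the CENTRE CONDITIONS `hctr` and the radius smallnesses `hbud` ∕ `hmq` (S30's S-U3 currency — (B1a)'s
operator-letter half is KERNEL only RELATIVE TO these); `hO` ∕ `hH`; (B1b)'s residue `terms` ∕ `emb` ∕ `hscale`; (B3) = `hM3` on S30's
EXPLICIT letters — G-ne9p2-5, UNPRINTED, shared with NE9, a BINDER, never `[cite:`-tagged; the located clauses «κ large»
`r₁ + 2·(64·log 162) + 2 ≤ R` and «ε₁ small» `A′·(e^{5r₁+1}·K₀(64,8)·9·64) ≤ 1` ((B5)-KIND SHAPES; their standing against print's NUMBERS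
is untouched).  (B4) is discharged BY NAME on pv22's CONSTRUCTED torus geometry (pv22's READING of 𝐃_{k+1} ∕ d_{k+1}, DIVERGENCE
D-pv22.3, not asserted here); WHICH tables `base` ∕ `rd` ∕ `coords` realise Bałaban's `C^{(k)}(Z₀,σ)`, `Γ_k` of [Balaban1988RGII] (2.14)
p. 15, whether the datum of record meets the centre conditions, and the identification of the class centre with run B's operator datum
of record are the SUBSTRATE's ∕ the owner's DISPLAYED readings, NOT claimed; no wall item of NE1′ or NE5 moves; wall v1.7 (T4-DAG v47)
does NOT move; R-t4r2-Q2 NOT met thereby.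
HONEST FRAMING.  Kernel bookkeeping — by-name composition of S46 (letters) with the S24–S31∕S37∕S45 torus pattern; cores ∕ letters ∕
`actOfLetters` are the cell's typed FORMAT of (2.14) and the substrate's slot of record, NOT Bałaban's functions; printed loci ((2.14)
p. 15, (2.18) p. 16, (2.27) ∕ (2.30) p. 18, (2.38) ∕ (2.41) p. 20; [Balaban1987RGI] p. 251, p. 257) are TYPE ∕ CONTEXT through the
imported [cite]-tagged Literature modules, re-asserted nowhere; ABSOLUTE RULE honoured ([folklore] kernel lemmas only); no numeral of
print.  NE1′ ⇐ the named binders — NOT printed, NOT proved; 0 leaves instantiated on Bałaban's densities; spine PROVED 0∕9; count 9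
unchanged.  Rung (B)+1 on ONE finite four-torus — NOT infinite volume, NOT a mass gap, NOT OS on ℝ⁴, NOT Clay.  HONEST DEPENDENCY:
continuum YM on T⁴ ⇐ BetaPertH ∧ nine spine estimates (0/9 proved); BetaPertH ⇐ (D1) ∧ (D4) ∧ CAP+tail; G-an2-4 gates asym, D1 and
NE2/3/4.
-/

noncomputable section

namespace Summit.QuantumFields.BalabanUV.T4Continuum.NE1p.DressedSourceAnalyticSlotLettersTorus

open scoped BigOperators Matrix
open Metric Set MeasureTheory
open Literature.MathematicalPhysics.QuantumFieldTheory.Balaban1983to89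
open Literature.MathematicalPhysics.QuantumFieldTheory.Balaban1983to89.B13Resummation (locE)
open Literature.MathematicalPhysics.QuantumFieldTheory.Balaban1983to89.B5Prop11Lower (nsq)
open Literature.MathematicalPhysics.QuantumFieldTheory.Balaban1983to89.TreeLengthTorus (tsys torusTreeLen)
open Literature.MathematicalPhysics.QuantumFieldTheory.Balaban1983to89.TreeLengthTorusGeometry (TTouch tgeometry)
open Literature.MathematicalPhysics.QuantumFieldTheory.Balaban1983to89.B12TreeDecay (K₀)
open Summit.QuantumFields.BalabanUV.T4Continuum.B13HistMeasurable (MeasPotFrame B13HistM)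
open Summit.QuantumFields.BalabanUV.T4Continuum.SubstrateTwoRunsDriven (DrivenRuns)
open Summit.QuantumFields.BalabanUV.T4Continuum.SubstrateActivities (coreOf actOfLetters)
open Summit.QuantumFields.BalabanUV.T4Continuum.SubstrateGaussianLetters (gaussC linForm)
open Summit.QuantumFields.BalabanUV.T4Continuum.SubstrateGaussianLettersBall (detBudget)
open Summit.QuantumFields.BalabanUV.T4Continuum.SubstrateSlotsOfRecord (ActLetters coreLettersOf)
open Summit.QuantumFields.BalabanUV.T4Continuum.NE1p.DressedSmallFieldOnCoresSlotLetters (margin_pos hN_coreLettersOf hq_coreLettersOf)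
open Summit.QuantumFields.BalabanUV.T4Continuum.NE1p.DressedSourceAnalyticOnCores (analytic_and_bounded_locE_of_actOfLetters)
open Summit.QuantumFields.BalabanUV.T4Continuum.NE1p.DressedJointAnalyticOnCores (analytic_and_bounded_locE_opSource_of_actOfLetters)
open Summit.QuantumFields.BalabanUV.T4Continuum.NE1p.DressedSourceAnalyticSlotLetters (analytic_and_bounded_locE_of_coreLettersOf
  muDeriv_locE_le_of_coreLettersOf analytic_and_bounded_locE_opSource_of_coreLettersOf)
open Summit.QuantumFields.BalabanUV.T4Continuum.NE1p.DressedSmallFieldGeometry (torus_consts)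
open Summit.QuantumFields.BalabanUV.T4Continuum.NE1p.DressedSmallFieldGeometryFaces (K₀_four)

variable {G : Type} [GaugeGroup G] (D : DrivenRuns G) (P : MeasPotFrame D.carriers) {N : ℕ} [NeZero N]

/-! ## §1 S46's three analytic ENDs at `coreLettersOf A` ON THE TORUS `tgeometry 4 N` — no geometry hypothesis, no operator-letter block -/

section CoreLettersOf

variable (Op : Type) [NormedAddCommGroup Op] [NormedSpace ℂ Op] {J : Type}
  (𝒵 : D.carriers.Dom → J → Type) [∀ Z j, Fintype (𝒵 Z j)] (dom : ∀ Z j, 𝒵 Z j → D.carriers.Dom)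
  (Jc : D.carriers.Dom → J → Type) [∀ Z j, Fintype (Jc Z j)]
  (V : D.carriers.Dom → J → Type) [∀ Z j, NormedAddCommGroup (V Z j)] [∀ Z j, InnerProductSpace ℝ (V Z j)]
  [∀ Z j, MeasurableSpace (V Z j)] [∀ Z j, BorelSpace (V Z j)] [∀ Z j, FiniteDimensional ℝ (V Z j)]
  (mI : D.carriers.Dom → J → Type) [∀ Z j, Fintype (mI Z j)] [∀ Z j, DecidableEq (mI Z j)]

open Classical in
/-- **HOLOMORPHY IN THE SOURCE + THE (2.41) ENVELOPE OF THE DRESSED OUTPUT OF THE SLOT ACTIVITIES AT THE CORE LETTERS OF RECORD, ON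
THE TORUS** (kernel; S46 §2 `analytic_and_bounded_locE_of_coreLettersOf` ONCE BY NAME at `𝔇 := tsys 4 N`, `Ge := tgeometry 4 N`,
`b₅ := 5·r₁`, constants located by N0o `torus_consts` + S24 `K₀_four`): binders = S46 §2's with the geometry GONE; conclusion = S37 §2's
torus currency at `ℓ := coreLettersOf … A`. [folklore] -/
theorem analytic_and_bounded_locE_of_coreLettersOf_torus {W : Set (ℕ → ℝ)} {ctr : ℕ → (ℕ → ℝ) → D.carriers.BgB → Op × B13HistM P}
    {ROp RHist R' : ℕ → ℝ} (A : ∀ Z j, ActLetters D P Op 𝒵 dom Jc V mI Z j) {β₀ ϑ d₀ γ : D.carriers.Dom → J → ℝ}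
    (hroom : ∀ k, ROp k < R' k) (hR' : ∀ k, 0 ≤ R' k)
    (hbase : ∀ Z j ii jj, Measurable fun a => (A Z j).base a ii jj)
    (hrdm : ∀ Z j ii jj (o' : Op), Measurable fun a => (A Z j).rd a ii jj o')
    (hβ₀ : ∀ Z j, 0 ≤ β₀ Z j) (hd₀ : ∀ Z j, 0 < d₀ Z j)
    (hrd : ∀ Z j a ii jj, ‖(A Z j).rd a ii jj‖ ≤ ϑ Z j)
    (hctr : ∀ k, ∀ g ∈ W, ∀ (U : D.carriers.BgB) (Z : D.carriers.Dom) (j : J) (a : (Jc Z j ⊕ 𝒵 Z j) → ℝ × ℝ),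
      (∀ ii jj, ‖linForm (A Z j).base (A Z j).rd (ctr k g U).1 a ii jj‖ ≤ β₀ Z j) ∧
      ((linForm (A Z j).base (A Z j).rd (ctr k g U).1 a).det).im = 0 ∧ d₀ Z j ≤ ((linForm (A Z j).base (A Z j).rd (ctr k g U).1 a).det).re ∧
      (∀ x : mI Z j → ℂ, γ Z j * nsq x ≤ (star x ⬝ᵥ (linForm (A Z j).base (A Z j).rd (ctr k g U).1 a *ᵥ x)).re))
    (hbud : ∀ k Z j, detBudget (Fintype.card (mI Z j)) (β₀ Z j) (ϑ Z j) (R' k) < d₀ Z j)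
    (hmq : ∀ k Z j, Fintype.card (mI Z j) * ϑ Z j * R' k < γ Z j)
    {k : ℕ} {g : ℕ → ℝ} (hg : g ∈ W) {U : D.carriers.BgB} {o : Op} {h₀ v : B13HistM P} {μ₁ : ℝ}
    (hO : ‖o - (ctr k g U).1‖ ≤ ROp k) (hH : ‖h₀ - (ctr k g U).2‖ + μ₁ * ‖v‖ ≤ RHist k)
    {emb : (tsys 4 N).Dom → D.carriers.Dom} (hscale : ∀ Z, D.carriers.scale (emb Z) = k)
    (terms : (tsys 4 N).Dom → Finset (D.carriers.Dom × J))
    {A' R r₁ : ℝ} (X₀ : (tsys 4 N).Dom) (hA : 0 ≤ A') (hr₁ : 0 ≤ r₁)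
    (hrate : r₁ + 2 * (64 * Real.log 162) + 2 ≤ R) (hsmall : A' * Real.exp (5 * r₁ + 1) * K₀ 64 8 * 9 * 64 ≤ 1)
    (hM3 : ∀ Z : (tsys 4 N).Dom, Z.1 ⊆ X₀.1 →
      ∑ p ∈ terms Z, (coreOf P Op 𝒵 dom Jc V (coreLettersOf D P Op 𝒵 dom Jc V mI A) p.1 p.2).lam.real univ *
          ((coreOf P Op 𝒵 dom Jc V (coreLettersOf D P Op 𝒵 dom Jc V mI A) p.1 p.2).wB *
              (gaussC (mI p.1 p.2) * Real.sqrt (max 1 ((Fintype.card (mI p.1 p.2)).factorial *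
                β₀ p.1 p.2 ^ Fintype.card (mI p.1 p.2) + d₀ p.1 p.2))) * Real.exp 0) *
          (Real.pi / ((γ p.1 p.2 - Fintype.card (mI p.1 p.2) * ϑ p.1 p.2 * R' k) / 2 / 2)) ^ (Module.finrank ℝ (V p.1 p.2) / 2 : ℝ) *
        Real.exp ((coreOf P Op 𝒵 dom Jc V (coreLettersOf D P Op 𝒵 dom Jc V mI A) p.1 p.2).N₁ * (‖h₀‖ + μ₁ * ‖v‖)) ≤
        A' * Real.exp (-(R * torusTreeLen Z.1))) :
    DifferentiableOn ℂ (fun s => locE (Dom := (tsys 4 N).Dom) (TTouch (d := 4) (N := N)) (fun Z : (tsys 4 N).Dom => Z.1) (fun Z => ∑ p ∈ terms Z,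
        actOfLetters P Op 𝒵 dom Jc V (coreLettersOf D P Op 𝒵 dom Jc V mI A) p.1 p.2 o (h₀ + s • v)) X₀.1) (ball (0 : ℂ) μ₁) ∧
      ∀ s ∈ ball (0 : ℂ) μ₁, ‖locE (Dom := (tsys 4 N).Dom) (TTouch (d := 4) (N := N)) (fun Z : (tsys 4 N).Dom => Z.1) (fun Z => ∑ p ∈ terms Z,
          actOfLetters P Op 𝒵 dom Jc V (coreLettersOf D P Op 𝒵 dom Jc V mI A) p.1 p.2 o (h₀ + s • v)) X₀.1‖ ≤
        Real.exp 1 * 9 * 64 * K₀ 64 8 ^ 2 * A' * Real.exp (-(r₁ * torusTreeLen X₀.1)) := by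
  obtain ⟨hν, hκ, hc⟩ := torus_consts N
  have hK₀ := K₀_four (N := N)
  have h := analytic_and_bounded_locE_of_coreLettersOf D P Op 𝒵 dom Jc V mI (tsys 4 N) (tgeometry 4 N) A hroom hR' hbase hrdm hβ₀
    hd₀ hrd hctr hbud hmq hg hO hH hscale terms (R := R) (b₅ := 5 * r₁) (X₀ := X₀) hA hr₁ (le_of_eq (by ring))
    (by rw [hκ]; exact hrate) (by rw [hK₀, hν, hc]; exact hsmall) hM3
  rw [hν, hc, hK₀] at h
  exact h

open Classical in
/-- **LINEAR RESPONSE OF THE DRESSED OUTPUT OF THE SLOT ACTIVITIES AT THE CORE LETTERS OF RECORD, ON THE TORUS** (kernel; S46 §2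
`muDeriv_locE_le_of_coreLettersOf` ONCE BY NAME at `tgeometry 4 N`): for `‖sμ‖ ≤ μ₀ < μ₁` the source derivative of
`s ↦ E[Σ actOfLetters (coreLettersOf A) … o (h₀ + s • v)](X₀)` at `sμ` is `≤ 2·(e·9·64·K₀(64,8)²·A′·e^{−r₁·torusTreeLen X₀})∕(μ₁ − μ₀)` —
S37 §2's response currency. [folklore] -/
theorem muDeriv_locE_le_of_coreLettersOf_torus {W : Set (ℕ → ℝ)} {ctr : ℕ → (ℕ → ℝ) → D.carriers.BgB → Op × B13HistM P}
    {ROp RHist R' : ℕ → ℝ} (A : ∀ Z j, ActLetters D P Op 𝒵 dom Jc V mI Z j) {β₀ ϑ d₀ γ : D.carriers.Dom → J → ℝ}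
    (hroom : ∀ k, ROp k < R' k) (hR' : ∀ k, 0 ≤ R' k)
    (hbase : ∀ Z j ii jj, Measurable fun a => (A Z j).base a ii jj)
    (hrdm : ∀ Z j ii jj (o' : Op), Measurable fun a => (A Z j).rd a ii jj o')
    (hβ₀ : ∀ Z j, 0 ≤ β₀ Z j) (hd₀ : ∀ Z j, 0 < d₀ Z j)
    (hrd : ∀ Z j a ii jj, ‖(A Z j).rd a ii jj‖ ≤ ϑ Z j)
    (hctr : ∀ k, ∀ g ∈ W, ∀ (U : D.carriers.BgB) (Z : D.carriers.Dom) (j : J) (a : (Jc Z j ⊕ 𝒵 Z j) → ℝ × ℝ),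
      (∀ ii jj, ‖linForm (A Z j).base (A Z j).rd (ctr k g U).1 a ii jj‖ ≤ β₀ Z j) ∧
      ((linForm (A Z j).base (A Z j).rd (ctr k g U).1 a).det).im = 0 ∧ d₀ Z j ≤ ((linForm (A Z j).base (A Z j).rd (ctr k g U).1 a).det).re ∧
      (∀ x : mI Z j → ℂ, γ Z j * nsq x ≤ (star x ⬝ᵥ (linForm (A Z j).base (A Z j).rd (ctr k g U).1 a *ᵥ x)).re))
    (hbud : ∀ k Z j, detBudget (Fintype.card (mI Z j)) (β₀ Z j) (ϑ Z j) (R' k) < d₀ Z j)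
    (hmq : ∀ k Z j, Fintype.card (mI Z j) * ϑ Z j * R' k < γ Z j)
    {k : ℕ} {g : ℕ → ℝ} (hg : g ∈ W) {U : D.carriers.BgB} {o : Op} {h₀ v : B13HistM P} {μ₁ : ℝ}
    (hO : ‖o - (ctr k g U).1‖ ≤ ROp k) (hH : ‖h₀ - (ctr k g U).2‖ + μ₁ * ‖v‖ ≤ RHist k)
    {emb : (tsys 4 N).Dom → D.carriers.Dom} (hscale : ∀ Z, D.carriers.scale (emb Z) = k)
    (terms : (tsys 4 N).Dom → Finset (D.carriers.Dom × J))
    {A' R r₁ μ₀ : ℝ} (X₀ : (tsys 4 N).Dom) {sμ : ℂ} (hA : 0 ≤ A') (hr₁ : 0 ≤ r₁)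
    (hrate : r₁ + 2 * (64 * Real.log 162) + 2 ≤ R) (hsmall : A' * Real.exp (5 * r₁ + 1) * K₀ 64 8 * 9 * 64 ≤ 1)
    (hM3 : ∀ Z : (tsys 4 N).Dom, Z.1 ⊆ X₀.1 →
      ∑ p ∈ terms Z, (coreOf P Op 𝒵 dom Jc V (coreLettersOf D P Op 𝒵 dom Jc V mI A) p.1 p.2).lam.real univ *
          ((coreOf P Op 𝒵 dom Jc V (coreLettersOf D P Op 𝒵 dom Jc V mI A) p.1 p.2).wB *
              (gaussC (mI p.1 p.2) * Real.sqrt (max 1 ((Fintype.card (mI p.1 p.2)).factorial *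
                β₀ p.1 p.2 ^ Fintype.card (mI p.1 p.2) + d₀ p.1 p.2))) * Real.exp 0) *
          (Real.pi / ((γ p.1 p.2 - Fintype.card (mI p.1 p.2) * ϑ p.1 p.2 * R' k) / 2 / 2)) ^ (Module.finrank ℝ (V p.1 p.2) / 2 : ℝ) *
        Real.exp ((coreOf P Op 𝒵 dom Jc V (coreLettersOf D P Op 𝒵 dom Jc V mI A) p.1 p.2).N₁ * (‖h₀‖ + μ₁ * ‖v‖)) ≤
        A' * Real.exp (-(R * torusTreeLen Z.1)))
    (h01 : μ₀ < μ₁) (hμ : ‖sμ‖ ≤ μ₀) :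
    ‖deriv (fun s => locE (Dom := (tsys 4 N).Dom) (TTouch (d := 4) (N := N)) (fun Z : (tsys 4 N).Dom => Z.1) (fun Z => ∑ p ∈ terms Z,
        actOfLetters P Op 𝒵 dom Jc V (coreLettersOf D P Op 𝒵 dom Jc V mI A) p.1 p.2 o (h₀ + s • v)) X₀.1) sμ‖ ≤
      2 * (Real.exp 1 * 9 * 64 * K₀ 64 8 ^ 2 * A' * Real.exp (-(r₁ * torusTreeLen X₀.1))) / (μ₁ - μ₀) := by
  obtain ⟨hν, hκ, hc⟩ := torus_consts N
  have hK₀ := K₀_four (N := N)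
  have h := muDeriv_locE_le_of_coreLettersOf D P Op 𝒵 dom Jc V mI (tsys 4 N) (tgeometry 4 N) A hroom hR' hbase hrdm hβ₀ hd₀ hrd
    hctr hbud hmq hg hO hH hscale terms (R := R) (b₅ := 5 * r₁) (X₀ := X₀) (sμ := sμ) hA hr₁ (le_of_eq (by ring))
    (by rw [hκ]; exact hrate) (by rw [hK₀, hν, hc]; exact hsmall) hM3 h01 hμ
  rw [hν, hc, hK₀] at h
  exact h

open Classical in
/-- **JOINT HOLOMORPHY IN (OPERATOR DATUM, SOURCE) + THE (2.41) ENVELOPE OF THE DRESSED OUTPUT OF THE SLOT ACTIVITIES AT THE CORE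
LETTERS OF RECORD, ON THE TORUS** (kernel; S46 §3 `analytic_and_bounded_locE_opSource_of_coreLettersOf` ONCE BY NAME at `tgeometry 4 N`
— S30 §1's operator-HOLOMORPHY clauses load-bearing as in S46 §3): binders = the holomorphy face's WITHOUT `o` ∕ `hO`; conclusion = S45's
torus currency at `ℓ := coreLettersOf … A` on `ball (ctr k g U).1 (ROp k) ×ˢ ball 0 μ₁`. [folklore] -/
theorem analytic_and_bounded_locE_opSource_of_coreLettersOf_torus {W : Set (ℕ → ℝ)} {ctr : ℕ → (ℕ → ℝ) → D.carriers.BgB → Op × B13HistM P}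
    {ROp RHist R' : ℕ → ℝ} (A : ∀ Z j, ActLetters D P Op 𝒵 dom Jc V mI Z j) {β₀ ϑ d₀ γ : D.carriers.Dom → J → ℝ}
    (hroom : ∀ k, ROp k < R' k) (hR' : ∀ k, 0 ≤ R' k)
    (hbase : ∀ Z j ii jj, Measurable fun a => (A Z j).base a ii jj)
    (hrdm : ∀ Z j ii jj (o' : Op), Measurable fun a => (A Z j).rd a ii jj o')
    (hβ₀ : ∀ Z j, 0 ≤ β₀ Z j) (hd₀ : ∀ Z j, 0 < d₀ Z j)
    (hrd : ∀ Z j a ii jj, ‖(A Z j).rd a ii jj‖ ≤ ϑ Z j)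
    (hctr : ∀ k, ∀ g ∈ W, ∀ (U : D.carriers.BgB) (Z : D.carriers.Dom) (j : J) (a : (Jc Z j ⊕ 𝒵 Z j) → ℝ × ℝ),
      (∀ ii jj, ‖linForm (A Z j).base (A Z j).rd (ctr k g U).1 a ii jj‖ ≤ β₀ Z j) ∧
      ((linForm (A Z j).base (A Z j).rd (ctr k g U).1 a).det).im = 0 ∧ d₀ Z j ≤ ((linForm (A Z j).base (A Z j).rd (ctr k g U).1 a).det).re ∧
      (∀ x : mI Z j → ℂ, γ Z j * nsq x ≤ (star x ⬝ᵥ (linForm (A Z j).base (A Z j).rd (ctr k g U).1 a *ᵥ x)).re))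
    (hbud : ∀ k Z j, detBudget (Fintype.card (mI Z j)) (β₀ Z j) (ϑ Z j) (R' k) < d₀ Z j)
    (hmq : ∀ k Z j, Fintype.card (mI Z j) * ϑ Z j * R' k < γ Z j)
    {k : ℕ} {g : ℕ → ℝ} (hg : g ∈ W) {U : D.carriers.BgB} {h₀ v : B13HistM P} {μ₁ : ℝ}
    (hH : ‖h₀ - (ctr k g U).2‖ + μ₁ * ‖v‖ ≤ RHist k)
    {emb : (tsys 4 N).Dom → D.carriers.Dom} (hscale : ∀ Z, D.carriers.scale (emb Z) = k)
    (terms : (tsys 4 N).Dom → Finset (D.carriers.Dom × J))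
    {A' R r₁ : ℝ} (X₀ : (tsys 4 N).Dom) (hA : 0 ≤ A') (hr₁ : 0 ≤ r₁)
    (hrate : r₁ + 2 * (64 * Real.log 162) + 2 ≤ R) (hsmall : A' * Real.exp (5 * r₁ + 1) * K₀ 64 8 * 9 * 64 ≤ 1)
    (hM3 : ∀ Z : (tsys 4 N).Dom, Z.1 ⊆ X₀.1 →
      ∑ p ∈ terms Z, (coreOf P Op 𝒵 dom Jc V (coreLettersOf D P Op 𝒵 dom Jc V mI A) p.1 p.2).lam.real univ *
          ((coreOf P Op 𝒵 dom Jc V (coreLettersOf D P Op 𝒵 dom Jc V mI A) p.1 p.2).wB *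
              (gaussC (mI p.1 p.2) * Real.sqrt (max 1 ((Fintype.card (mI p.1 p.2)).factorial *
                β₀ p.1 p.2 ^ Fintype.card (mI p.1 p.2) + d₀ p.1 p.2))) * Real.exp 0) *
          (Real.pi / ((γ p.1 p.2 - Fintype.card (mI p.1 p.2) * ϑ p.1 p.2 * R' k) / 2 / 2)) ^ (Module.finrank ℝ (V p.1 p.2) / 2 : ℝ) *
        Real.exp ((coreOf P Op 𝒵 dom Jc V (coreLettersOf D P Op 𝒵 dom Jc V mI A) p.1 p.2).N₁ * (‖h₀‖ + μ₁ * ‖v‖)) ≤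
        A' * Real.exp (-(R * torusTreeLen Z.1))) :
    DifferentiableOn ℂ (fun z : Op × ℂ => locE (Dom := (tsys 4 N).Dom) (TTouch (d := 4) (N := N)) (fun Z : (tsys 4 N).Dom => Z.1) (fun Z => ∑ p ∈ terms Z,
        actOfLetters P Op 𝒵 dom Jc V (coreLettersOf D P Op 𝒵 dom Jc V mI A) p.1 p.2 z.1 (h₀ + z.2 • v)) X₀.1)
        (ball (ctr k g U).1 (ROp k) ×ˢ ball (0 : ℂ) μ₁) ∧
      ∀ z ∈ ball (ctr k g U).1 (ROp k) ×ˢ ball (0 : ℂ) μ₁, ‖locE (Dom := (tsys 4 N).Dom) (TTouch (d := 4) (N := N)) (fun Z : (tsys 4 N).Dom => Z.1) (fun Z => ∑ p ∈ terms Z,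
          actOfLetters P Op 𝒵 dom Jc V (coreLettersOf D P Op 𝒵 dom Jc V mI A) p.1 p.2 z.1 (h₀ + z.2 • v)) X₀.1‖ ≤
        Real.exp 1 * 9 * 64 * K₀ 64 8 ^ 2 * A' * Real.exp (-(r₁ * torusTreeLen X₀.1)) := by
  obtain ⟨hν, hκ, hc⟩ := torus_consts N
  have hK₀ := K₀_four (N := N)
  have h := analytic_and_bounded_locE_opSource_of_coreLettersOf D P Op 𝒵 dom Jc V mI (tsys 4 N) (tgeometry 4 N) A hroom hR' hbase
    hrdm hβ₀ hd₀ hrd hctr hbud hmq hg hH hscale terms (R := R) (b₅ := 5 * r₁) (X₀ := X₀) hA hr₁ (le_of_eq (by ring))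
    (by rw [hκ]; exact hrate) (by rw [hK₀, hν, hc]; exact hsmall) hM3
  rw [hν, hc, hK₀] at h
  exact h

/-! ## §2 THE COMMUTING SQUARES IN KERNEL (torus-then-letters = letters-then-torus) — no new inequality -/

open Classical in
/-- (consistency, in kernel) §1's `analytic_and_bounded_locE_of_coreLettersOf_torus` IS the unit's S33 §4
`analytic_and_bounded_locE_of_actOfLetters` AT pv22's torus geometry — i.e. what S37 §2's `analytic_and_bounded_locE_of_actOfLetters_torus`
unfolds to — at `ℓ := coreLettersOf D P Op 𝒵 dom Jc V mI A` with S30 §1's three block producers `margin_pos` ∕ `hN_coreLettersOf` ∕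
`hq_coreLettersOf` BY NAME: the same statement closed the other way round the square (S33 §4 ∘ S30 §1 at the torus in place of S46 §2 at
the torus).  S37 itself is not in this file's import cone; the square is written against the END S37 is ONE application of. [folklore] -/
example {W : Set (ℕ → ℝ)} {ctr : ℕ → (ℕ → ℝ) → D.carriers.BgB → Op × B13HistM P}
    {ROp RHist R' : ℕ → ℝ} (A : ∀ Z j, ActLetters D P Op 𝒵 dom Jc V mI Z j) {β₀ ϑ d₀ γ : D.carriers.Dom → J → ℝ}
    (hroom : ∀ k, ROp k < R' k) (hR' : ∀ k, 0 ≤ R' k)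
    (hbase : ∀ Z j ii jj, Measurable fun a => (A Z j).base a ii jj)
    (hrdm : ∀ Z j ii jj (o' : Op), Measurable fun a => (A Z j).rd a ii jj o')
    (hβ₀ : ∀ Z j, 0 ≤ β₀ Z j) (hd₀ : ∀ Z j, 0 < d₀ Z j)
    (hrd : ∀ Z j a ii jj, ‖(A Z j).rd a ii jj‖ ≤ ϑ Z j)
    (hctr : ∀ k, ∀ g ∈ W, ∀ (U : D.carriers.BgB) (Z : D.carriers.Dom) (j : J) (a : (Jc Z j ⊕ 𝒵 Z j) → ℝ × ℝ),
      (∀ ii jj, ‖linForm (A Z j).base (A Z j).rd (ctr k g U).1 a ii jj‖ ≤ β₀ Z j) ∧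
      ((linForm (A Z j).base (A Z j).rd (ctr k g U).1 a).det).im = 0 ∧ d₀ Z j ≤ ((linForm (A Z j).base (A Z j).rd (ctr k g U).1 a).det).re ∧
      (∀ x : mI Z j → ℂ, γ Z j * nsq x ≤ (star x ⬝ᵥ (linForm (A Z j).base (A Z j).rd (ctr k g U).1 a *ᵥ x)).re))
    (hbud : ∀ k Z j, detBudget (Fintype.card (mI Z j)) (β₀ Z j) (ϑ Z j) (R' k) < d₀ Z j)
    (hmq : ∀ k Z j, Fintype.card (mI Z j) * ϑ Z j * R' k < γ Z j)
    {k : ℕ} {g : ℕ → ℝ} (hg : g ∈ W) {U : D.carriers.BgB} {o : Op} {h₀ v : B13HistM P} {μ₁ : ℝ}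
    (hO : ‖o - (ctr k g U).1‖ ≤ ROp k) (hH : ‖h₀ - (ctr k g U).2‖ + μ₁ * ‖v‖ ≤ RHist k)
    {emb : (tsys 4 N).Dom → D.carriers.Dom} (hscale : ∀ Z, D.carriers.scale (emb Z) = k)
    (terms : (tsys 4 N).Dom → Finset (D.carriers.Dom × J))
    {A' R r₁ : ℝ} (X₀ : (tsys 4 N).Dom) (hA : 0 ≤ A') (hr₁ : 0 ≤ r₁)
    (hrate : r₁ + 2 * (64 * Real.log 162) + 2 ≤ R) (hsmall : A' * Real.exp (5 * r₁ + 1) * K₀ 64 8 * 9 * 64 ≤ 1)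
    (hM3 : ∀ Z : (tsys 4 N).Dom, Z.1 ⊆ X₀.1 →
      ∑ p ∈ terms Z, (coreOf P Op 𝒵 dom Jc V (coreLettersOf D P Op 𝒵 dom Jc V mI A) p.1 p.2).lam.real univ *
          ((coreOf P Op 𝒵 dom Jc V (coreLettersOf D P Op 𝒵 dom Jc V mI A) p.1 p.2).wB *
              (gaussC (mI p.1 p.2) * Real.sqrt (max 1 ((Fintype.card (mI p.1 p.2)).factorial *
                β₀ p.1 p.2 ^ Fintype.card (mI p.1 p.2) + d₀ p.1 p.2))) * Real.exp 0) *
          (Real.pi / ((γ p.1 p.2 - Fintype.card (mI p.1 p.2) * ϑ p.1 p.2 * R' k) / 2 / 2)) ^ (Module.finrank ℝ (V p.1 p.2) / 2 : ℝ) *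
        Real.exp ((coreOf P Op 𝒵 dom Jc V (coreLettersOf D P Op 𝒵 dom Jc V mI A) p.1 p.2).N₁ * (‖h₀‖ + μ₁ * ‖v‖)) ≤
        A' * Real.exp (-(R * torusTreeLen Z.1))) :
    DifferentiableOn ℂ (fun s => locE (Dom := (tsys 4 N).Dom) (TTouch (d := 4) (N := N)) (fun Z : (tsys 4 N).Dom => Z.1) (fun Z => ∑ p ∈ terms Z,
        actOfLetters P Op 𝒵 dom Jc V (coreLettersOf D P Op 𝒵 dom Jc V mI A) p.1 p.2 o (h₀ + s • v)) X₀.1) (ball (0 : ℂ) μ₁) ∧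
      ∀ s ∈ ball (0 : ℂ) μ₁, ‖locE (Dom := (tsys 4 N).Dom) (TTouch (d := 4) (N := N)) (fun Z : (tsys 4 N).Dom => Z.1) (fun Z => ∑ p ∈ terms Z,
          actOfLetters P Op 𝒵 dom Jc V (coreLettersOf D P Op 𝒵 dom Jc V mI A) p.1 p.2 o (h₀ + s • v)) X₀.1‖ ≤
        Real.exp 1 * 9 * 64 * K₀ 64 8 ^ 2 * A' * Real.exp (-(r₁ * torusTreeLen X₀.1)) := by
  obtain ⟨hν, hκ, hc⟩ := torus_consts N
  have hK₀ := K₀_four (N := N)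
  have h := analytic_and_bounded_locE_of_actOfLetters P Op 𝒵 dom Jc V (tsys 4 N) (tgeometry 4 N)
    (coreLettersOf D P Op 𝒵 dom Jc V mI A)
    (mq := fun k p _ => (γ p.1 p.2 - Fintype.card (mI p.1 p.2) * ϑ p.1 p.2 * R' k) / 2) (bq := fun _ _ _ => 0)
    (N₀ := fun _ p _ => gaussC (mI p.1 p.2) *
      Real.sqrt (max 1 ((Fintype.card (mI p.1 p.2)).factorial * β₀ p.1 p.2 ^ Fintype.card (mI p.1 p.2) + d₀ p.1 p.2)))
    hroom (margin_pos D mI hmq) (hN_coreLettersOf D P Op 𝒵 dom Jc V mI A hR' hbase hrdm hβ₀ hd₀ hrd hctr hbud)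
    (hq_coreLettersOf D P Op 𝒵 dom Jc V mI A hbase hrdm hrd hctr) hg hO hH hscale terms (R := R) (b₅ := 5 * r₁) (X₀ := X₀) hA hr₁
    (le_of_eq (by ring)) (by rw [hκ]; exact hrate) (by rw [hK₀, hν, hc]; exact hsmall) hM3
  rw [hν, hc, hK₀] at h
  exact h

open Classical in
/-- (consistency, in kernel) §1's joint END IS the unit's S42 §5 `analytic_and_bounded_locE_opSource_of_actOfLetters` AT the torus
geometry (= what S45's `analytic_and_bounded_locE_opSource_of_actOfLetters_torus` unfolds to) at `ℓ := coreLettersOf … A` with S30 §1's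
blocks BY NAME. [folklore] -/
example {W : Set (ℕ → ℝ)} {ctr : ℕ → (ℕ → ℝ) → D.carriers.BgB → Op × B13HistM P}
    {ROp RHist R' : ℕ → ℝ} (A : ∀ Z j, ActLetters D P Op 𝒵 dom Jc V mI Z j) {β₀ ϑ d₀ γ : D.carriers.Dom → J → ℝ}
    (hroom : ∀ k, ROp k < R' k) (hR' : ∀ k, 0 ≤ R' k)
    (hbase : ∀ Z j ii jj, Measurable fun a => (A Z j).base a ii jj)
    (hrdm : ∀ Z j ii jj (o' : Op), Measurable fun a => (A Z j).rd a ii jj o')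
    (hβ₀ : ∀ Z j, 0 ≤ β₀ Z j) (hd₀ : ∀ Z j, 0 < d₀ Z j)
    (hrd : ∀ Z j a ii jj, ‖(A Z j).rd a ii jj‖ ≤ ϑ Z j)
    (hctr : ∀ k, ∀ g ∈ W, ∀ (U : D.carriers.BgB) (Z : D.carriers.Dom) (j : J) (a : (Jc Z j ⊕ 𝒵 Z j) → ℝ × ℝ),
      (∀ ii jj, ‖linForm (A Z j).base (A Z j).rd (ctr k g U).1 a ii jj‖ ≤ β₀ Z j) ∧
      ((linForm (A Z j).base (A Z j).rd (ctr k g U).1 a).det).im = 0 ∧ d₀ Z j ≤ ((linForm (A Z j).base (A Z j).rd (ctr k g U).1 a).det).re ∧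
      (∀ x : mI Z j → ℂ, γ Z j * nsq x ≤ (star x ⬝ᵥ (linForm (A Z j).base (A Z j).rd (ctr k g U).1 a *ᵥ x)).re))
    (hbud : ∀ k Z j, detBudget (Fintype.card (mI Z j)) (β₀ Z j) (ϑ Z j) (R' k) < d₀ Z j)
    (hmq : ∀ k Z j, Fintype.card (mI Z j) * ϑ Z j * R' k < γ Z j)
    {k : ℕ} {g : ℕ → ℝ} (hg : g ∈ W) {U : D.carriers.BgB} {h₀ v : B13HistM P} {μ₁ : ℝ}
    (hH : ‖h₀ - (ctr k g U).2‖ + μ₁ * ‖v‖ ≤ RHist k)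
    {emb : (tsys 4 N).Dom → D.carriers.Dom} (hscale : ∀ Z, D.carriers.scale (emb Z) = k)
    (terms : (tsys 4 N).Dom → Finset (D.carriers.Dom × J))
    {A' R r₁ : ℝ} (X₀ : (tsys 4 N).Dom) (hA : 0 ≤ A') (hr₁ : 0 ≤ r₁)
    (hrate : r₁ + 2 * (64 * Real.log 162) + 2 ≤ R) (hsmall : A' * Real.exp (5 * r₁ + 1) * K₀ 64 8 * 9 * 64 ≤ 1)
    (hM3 : ∀ Z : (tsys 4 N).Dom, Z.1 ⊆ X₀.1 →
      ∑ p ∈ terms Z, (coreOf P Op 𝒵 dom Jc V (coreLettersOf D P Op 𝒵 dom Jc V mI A) p.1 p.2).lam.real univ *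
          ((coreOf P Op 𝒵 dom Jc V (coreLettersOf D P Op 𝒵 dom Jc V mI A) p.1 p.2).wB *
              (gaussC (mI p.1 p.2) * Real.sqrt (max 1 ((Fintype.card (mI p.1 p.2)).factorial *
                β₀ p.1 p.2 ^ Fintype.card (mI p.1 p.2) + d₀ p.1 p.2))) * Real.exp 0) *
          (Real.pi / ((γ p.1 p.2 - Fintype.card (mI p.1 p.2) * ϑ p.1 p.2 * R' k) / 2 / 2)) ^ (Module.finrank ℝ (V p.1 p.2) / 2 : ℝ) *
        Real.exp ((coreOf P Op 𝒵 dom Jc V (coreLettersOf D P Op 𝒵 dom Jc V mI A) p.1 p.2).N₁ * (‖h₀‖ + μ₁ * ‖v‖)) ≤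
        A' * Real.exp (-(R * torusTreeLen Z.1))) :
    DifferentiableOn ℂ (fun z : Op × ℂ => locE (Dom := (tsys 4 N).Dom) (TTouch (d := 4) (N := N)) (fun Z : (tsys 4 N).Dom => Z.1) (fun Z => ∑ p ∈ terms Z,
        actOfLetters P Op 𝒵 dom Jc V (coreLettersOf D P Op 𝒵 dom Jc V mI A) p.1 p.2 z.1 (h₀ + z.2 • v)) X₀.1)
        (ball (ctr k g U).1 (ROp k) ×ˢ ball (0 : ℂ) μ₁) ∧
      ∀ z ∈ ball (ctr k g U).1 (ROp k) ×ˢ ball (0 : ℂ) μ₁, ‖locE (Dom := (tsys 4 N).Dom) (TTouch (d := 4) (N := N)) (fun Z : (tsys 4 N).Dom => Z.1) (fun Z => ∑ p ∈ terms Z,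
          actOfLetters P Op 𝒵 dom Jc V (coreLettersOf D P Op 𝒵 dom Jc V mI A) p.1 p.2 z.1 (h₀ + z.2 • v)) X₀.1‖ ≤
        Real.exp 1 * 9 * 64 * K₀ 64 8 ^ 2 * A' * Real.exp (-(r₁ * torusTreeLen X₀.1)) := by
  obtain ⟨hν, hκ, hc⟩ := torus_consts N
  have hK₀ := K₀_four (N := N)
  have h := analytic_and_bounded_locE_opSource_of_actOfLetters P Op 𝒵 dom Jc V (tsys 4 N) (tgeometry 4 N)
    (coreLettersOf D P Op 𝒵 dom Jc V mI A)
    (mq := fun k p _ => (γ p.1 p.2 - Fintype.card (mI p.1 p.2) * ϑ p.1 p.2 * R' k) / 2) (bq := fun _ _ _ => 0)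
    (N₀ := fun _ p _ => gaussC (mI p.1 p.2) *
      Real.sqrt (max 1 ((Fintype.card (mI p.1 p.2)).factorial * β₀ p.1 p.2 ^ Fintype.card (mI p.1 p.2) + d₀ p.1 p.2)))
    hroom (margin_pos D mI hmq) (hN_coreLettersOf D P Op 𝒵 dom Jc V mI A hR' hbase hrdm hβ₀ hd₀ hrd hctr hbud)
    (hq_coreLettersOf D P Op 𝒵 dom Jc V mI A hbase hrdm hrd hctr) hg hH hscale terms (R := R) (b₅ := 5 * r₁) (X₀ := X₀) hA hr₁
    (le_of_eq (by ring)) (by rw [hκ]; exact hrate) (by rw [hK₀, hν, hc]; exact hsmall) hM3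
  rw [hν, hc, hK₀] at h
  exact h

end CoreLettersOf

end Summit.QuantumFields.BalabanUV.T4Continuum.NE1p.DressedSourceAnalyticSlotLettersTorus

end
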